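import Literature.AlgebraicGeometry.Resolution.CharPolyhedronSolvableVertex
import Mathlib.Algebra.Order.Sub.Prod
import Mathlib.Data.Pi.Interval
import Mathlib.Data.Fin.Tuple.NatAntidiagonal
import HarnessLib

/-!
# Hironaka's vertex preparation in a complete local ring — existence, PROVED
# (Cossart–Piltant 2019, Prop. 2.2 (Hironaka) with Def. 2.4; Hironaka 1967, (3.10))

Topic: `Literature/AlgebraicGeometry/Resolution`. PROOF FILE (theorems only; no `def`, no named
fact, no instance) continuing `CharPolyhedronSolvableVertex.lean` (Def. 2.3 `IsSolvableVertex`,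
Def. 2.4 `IsMinimal`, and Prop. 2.2 "only if": `IsSolvableVertex.charPolyhedron_taylor_ssubset`)
and `CharPolyhedronVertexDissolution.lean` (the one-step dissolution computation).

Cossart–Piltant 2019 print (arXiv:1412.0868 v1, p. 11, Prop. 2.2 (Hironaka)): "There exists a
linear change of the `X`-coordinate `Z := X - θ`, with `θ ∈ Ŝ`, such that
`Δ_Ŝ(h; {u_j}_{j ∈ J}; Z) = min_{X'} Δ_Ŝ(h; {u_j}_{j ∈ J}; X')` […]. Given `X' := X - φ`,
`φ ∈ Ŝ`, `Δ_Ŝ(h; {u_j}_{j ∈ J}; X')` achieves equality in (2.4) if and only if it has no solvable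
vertex." with proof "This is respectively [H3] Hironaka's vertex preparation lemma (3.10) and
theorem (4.8)", and Def. 2.4: "`Δ_Ŝ(h; {u_j}_{j ∈ J}; X')` is minimal if it has no solvable
vertex."  This file PROVES the existence statement in the language of Def. 2.4, for a Noetherian
local ring `S` that is (pre)complete — the rôle of `Ŝ` in print:

* `exists_isMinimal_taylor` — `S` Noetherian local, `u₁, …, u_N ∈ m_S` with (H), `S`
  `(u)`-adically precomplete (`IsPrecomplete (u) S`), `h ∈ S[X]` monic ⇒
  `∃ θ, IsMinimal u (taylor θ h)` (`taylor θ h = h(X + θ)`, the tree's translation idiom of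
  `isMinimal_of_forall_subset`; in print `Z = X - (-θ)`);
* `exists_isMinimal_taylor_of_isAdicComplete`, `exists_isMinimal_comp_X_add_C` — the same for
  `S` complete in the `m_S`-adic topology (`[IsAdicComplete (maximalIdeal S) S]`; any `u ⊆ m_S`
  with (H), e.g. a regular system of parameters of a complete regular local ring or part of one),
  the second with the translate written `h.comp (X + C θ)`.

Proof (Hironaka's (3.10) convergence argument, made explicit): `exists_dissolution_step` —
dissolve a solvable vertex `x` of least degree `Σ x_j` by `X ↦ X + λ u^x` (tree:
`IsSolvableVertex.not_mem_charPolyhedron_taylor`, `charPolyhedron_taylor_subset`); iterate; the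
polyhedra decrease, so the dissolved vertices are pairwise distinct points of `ℕ^N` and their
degrees tend to infinity; the partial sums `θ_k` of the steps are `(u)`-adically Cauchy
(`λ u^x ∈ (u)^{Σ x}`), with limit `θ` (`IsPrecomplete`); TRUNCATION
(`mem_minExponents_iff_of_sub_mem_pow`, `coeffClass_eq_of_sub_mem_pow`: the elements of `𝐒(f)` of
degree `< c` and their classes `γ̄(f, a)` depend only on `f mod (u)^c`; hence
`IsVertexFor.of_coeff_sub_mem_pow`, `isSolvableVertex_of_coeff_sub_mem_pow`) shows that a solvable
vertex of `Δ(h(X + θ))` would be a solvable vertex of a late stage `Δ(h(X + θ_k))`, of degree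
smaller than the least-degree solvable vertex dissolved there — a contradiction. Auxiliary:
`isPrecomplete_of_le_of_isAdicComplete` (`m_S`-adically complete ⇒ `I`-adically precomplete for
`I ⊆ m_S`, by Krull's intersection theorem in `S ⧸ Iⁿ`).

Refinement (second part of the file): `exists_mem_isMinimal_taylor` /
`exists_mem_isMinimal_taylor_of_isAdicComplete` / `exists_mem_isMinimal_comp_X_add_C` — if
`δ_{α₀}(h; u; X) ≥ q₀` for a weight vector `α₀ ≥ 0` (zero entries allowed; i.e.
`f_{i,X} ∈ I_{α₀}(i q₀)`), the preparing `θ` can be taken in `I_{α₀}(q₀)` and then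
`δ_{α₀}(h(X + θ); u; X) ≥ q₀` persists (Cossart–Piltant 2019, §2.3, v1 p. 15: "By minimality, we
have `μ_α(φ) ≥ a := δ_α(h; u; Z)`"); tools: `IsVertexFor.le_weight_of_deltaGE` (a vertex of `Δ`
has `α₀`-weight `≥ q₀`), `mem_of_forall_mem_sup_pow` (ideals are adically closed, Krull),
`exists_dissolution_step_mul`.

Dictionary and packaging (third part): `monomialIdeal_indicator_eq_span_pow`
(`I_{1_J}(k) = (u_j : j ∈ J)^k`), `exists_mem_span_isMinimal_taylor_of_isAdicComplete` /
`exists_mem_span_isMinimal_comp_X_add_C` (the refinement for the ideal `(u_j : j ∈ J)`: the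
coefficient conditions `f_{i,X} ∈ (u_j : j ∈ J)^i` persist and `θ ∈ (u_j : j ∈ J)`);
`exists_isMinimal_taylor_of_isRsopPart`, `exists_isMinimal_taylor_of_rsop`,
`exists_isMinimal_comp_X_add_C_of_span_eq_maximalIdeal` (and their `exists_mem_span_…` forms) —
the printed setting, `u` (part of) a regular system of parameters of a complete regular local
ring, where (H) and `u ⊆ m_S` hold by Matsumura Thms. 14.3/17.8
(`MonomialIdealsRegularParameters.lean`); the last is the shape of the binder `hVP` of the
summit-side `exists_isCPFrame_of_presentation`, with the count `n = dim S`.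

Not treated: the "minimum w.r.t. inclusion" clause of Prop. 2.2 and its "if" direction
(Hironaka 1967, (4.8)); the algebraicity Prop. 2.4 ([CoP3]: `θ ∈ S` for excellent, not
necessarily complete, `S`).

## Sources

* V. Cossart, O. Piltant, *Resolution of singularities of arithmetical threefolds*, J. Algebra
  529 (2019) 268–535 = arXiv:1412.0868 v1, Ch. 2, p. 9 ((2.1)–(2.3): `h` monic, translations
  `X' = X - φ`), p. 10 (Prop. 2.1, Def. 2.1–2.2), p. 11 (Def. 2.3, Prop. 2.2 (Hironaka), Def. 2.4).
  [CossartPiltant2019]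
* Journal numbering (J. Algebra 529, the version of record of [CossartPiltant2019]; held text
  `paper:cossart2019-resolution-singularities-arithmetical-threefolds`, read on the page): arXiv v1
  Def. 2.3 (solvable vertices) = J Def. 2.6, p. 287; v1 Prop. 2.2 (Hironaka) = J Prop. 2.7
  (Hironaka), p. 287 (proof line: "[47] Hironaka's Vertex Preparation Lemma (3.10) and Theorem
  (4.8), and [32] Lemma II.1"); v1 Def. 2.4 (minimal) = J Def. 2.8, p. 287; v1 Prop. 2.3 =
  J Prop. 2.10, p. 288; v1 Def. 2.5 (`δ(y)`) = J Def. 2.11, p. 289; v1 Prop. 2.4 ([CoP3]) =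
  J Prop. 2.12, p. 289.  "arXiv v1 p. N" in this file is page N of the held arXiv text layer
  `paper:arxiv-1412.0868` (concordance: res-lit-6, DIM3-INDEX §24 (h)).
* H. Hironaka, *Characteristic polyhedra of singularities*, J. Math. Kyoto Univ. 7 (1967)
  251–293 (held: `paper:doi-10-1215-kjm-1250524227`; read on the page): Lemma (3.10), p. 279
  (vertex dissolution `z = y - d`: (3.10.1) `Δ(f; u; z) ⊆ Δ(f; u; y)`, (3.10.2) `Δ(f; u; z)`
  does not contain the dissolved vertex `v` but every other vertex) and Thm. (3.17),
  pp. 283–284 (`R` complete ⇒ a totally prepared `(g; z)` exists; proof p. 284: "we apply to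
  `f`, repeatedly and alternately, the vertex-normalization […] and the vertex-dissolution in
  the sense of Lemma (3.10)", in the ordering `|v|` first, then lexicographic) — the one-equation
  case `J = (h)`, `y = X` is Cossart–Piltant's Prop. 2.2 (1), whose proof line cites "(3.10)".
  [Hironaka1967]
* H. Matsumura, *Commutative Ring Theory*, CUP 1986, §8 (Thm. 8.10, Krull's intersection
  theorem; completeness). [Matsumura1987]
-/

noncomputable section

open Finset Polynomial IsLocalRing

namespace Literature.AlgebraicGeometry.Resolution.CossartPiltant

universe u

variable {S : Type u} [CommRing S] {N : ℕ}

/-! ## (T) Truncation: `𝐒(f)` and `γ̄(f, ·)` below degree `c` depend only on `f mod (u)^c` -/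

/-- If `f - f' ∈ (u)^c`, every `a' ∈ 𝐒(f')` of degree `< c` lies above some `b ∈ 𝐒(f)`.
[cite: CossartPiltant2019, Prop. 2.1 (arXiv v1 p. 10)] -/
theorem exists_le_of_mem_minExponents_of_sub_mem_pow [IsNoetherianRing S] [IsLocalRing S]
    (u : Fin N → S)
    (H : ∀ (i : Fin N) (T : Finset (Fin N)), i ∉ T →
      ∀ y, u i * y ∈ Ideal.span (u '' ↑T) → y ∈ Ideal.span (u '' ↑T))
    (hu : ∀ i, u i ∈ maximalIdeal S) {f f' : S} {c : ℕ}
    (hff' : f - f' ∈ Ideal.span (Set.range u) ^ c) {a' : Fin N → ℕ}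
    (ha' : a' ∈ minExponents u f') (hdeg : ∑ j, a' j < c) :
    ∃ b ∈ minExponents u f, b ≤ a' := by
  obtain ⟨-, hfA, -⟩ := minExponents_spec' u H hu f
  obtain ⟨-, -, hmin'⟩ := minExponents_spec' u H hu f'
  have hf'mem : f' ∈ Ideal.span (uPow u ''
      (↑(minExponents u f) ∪ {e : Fin N → ℕ | c ≤ ∑ l, e l})) := by
    have hrw : f' = f - (f - f') := by ring
    rw [hrw, Set.image_union, Ideal.span_union]
    refine sub_mem (Ideal.mem_sup_left hfA) (Ideal.mem_sup_right ?_)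
    rwa [← span_range_pow_eq_span_uPow]
  obtain ⟨b, hb, hba⟩ := hmin' _ hf'mem a' ha'
  rcases hb with hb | hb
  · exact ⟨b, hb, hba⟩
  · exfalso
    have hb' : c ≤ ∑ l, b l := hb
    have : ∑ l, b l ≤ ∑ l, a' l := Finset.sum_le_sum fun l _ => hba l
    omega

/-- **Truncation of `𝐒(f)`**: if `f - f' ∈ (u)^c` then `𝐒(f)` and `𝐒(f')` have the same elements
of degree `< c`. [cite: CossartPiltant2019, Prop. 2.1 (arXiv v1 p. 10)] -/
theorem mem_minExponents_iff_of_sub_mem_pow [IsNoetherianRing S] [IsLocalRing S]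
    (u : Fin N → S)
    (H : ∀ (i : Fin N) (T : Finset (Fin N)), i ∉ T →
      ∀ y, u i * y ∈ Ideal.span (u '' ↑T) → y ∈ Ideal.span (u '' ↑T))
    (hu : ∀ i, u i ∈ maximalIdeal S) {f f' : S} {c : ℕ}
    (hff' : f - f' ∈ Ideal.span (Set.range u) ^ c) {a : Fin N → ℕ} (hdeg : ∑ j, a j < c) :
    a ∈ minExponents u f ↔ a ∈ minExponents u f' := by
  have key : ∀ {g g' : S}, g - g' ∈ Ideal.span (Set.range u) ^ c →
      ∀ {a : Fin N → ℕ}, ∑ j, a j < c → a ∈ minExponents u g → a ∈ minExponents u g' := by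
    intro g g' hgg' a hdeg ha
    have hg'g : g' - g ∈ Ideal.span (Set.range u) ^ c := by
      rw [← neg_sub]
      exact Submodule.neg_mem _ hgg'
    -- `a ∈ 𝐒(g)` lies above some `b' ∈ 𝐒(g')`
    obtain ⟨b', hb', hb'a⟩ := exists_le_of_mem_minExponents_of_sub_mem_pow u H hu hg'g ha hdeg
    have hdeg' : ∑ j, b' j < c :=
      lt_of_le_of_lt (Finset.sum_le_sum fun l _ => hb'a l) hdeg
    -- which lies above some `b ∈ 𝐒(g)`; antichain forces `b = b' = a`
    obtain ⟨b, hb, hbb'⟩ := exists_le_of_mem_minExponents_of_sub_mem_pow u H hu hgg' hb' hdeg'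
    have hA := (minExponents_spec' u H hu g).1
    have hba : b = a := by
      by_contra hne
      exact hA (Finset.mem_coe.mpr hb) (Finset.mem_coe.mpr ha) hne (hbb'.trans hb'a)
    subst hba
    have : b' = b := le_antisymm hb'a hbb'
    subst this
    exact hb'
  have hf'f : f' - f ∈ Ideal.span (Set.range u) ^ c := by
    rw [← neg_sub]
    exact Submodule.neg_mem _ hff'
  exact ⟨key hff' hdeg, key hf'f hdeg⟩

/-- A monomial `u^d` with `d ≠ 0` lies in `(u)`. [folklore] -/
private theorem uPow_mem_span_range_of_ne_zero (u : Fin N → S) {d : Fin N → ℕ} (hd : d ≠ 0) :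
    uPow u d ∈ Ideal.span (Set.range u) := by
  have h1 : 1 ≤ ∑ j, d j := by
    by_contra hlt
    push Not at hlt
    apply hd
    funext j
    have := Finset.single_le_sum (fun i _ => Nat.zero_le (d i)) (Finset.mem_univ j)
    simp only [Pi.zero_apply]
    omega
  have := uPow_mem_span_pow u h1
  rwa [pow_one] at this

/-- **Truncation of the classes `γ̄(f, a)`**: if `f - f' ∈ (u)^c` then `γ̄(f, a) = γ̄(f', a)` for
every `a` of degree `< c`. [cite: CossartPiltant2019, Prop. 2.1 (ii) (arXiv v1 p. 10)] -/
theorem coeffClass_eq_of_sub_mem_pow [IsNoetherianRing S] [IsLocalRing S]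
    (u : Fin N → S)
    (H : ∀ (i : Fin N) (T : Finset (Fin N)), i ∉ T →
      ∀ y, u i * y ∈ Ideal.span (u '' ↑T) → y ∈ Ideal.span (u '' ↑T))
    (hu : ∀ i, u i ∈ maximalIdeal S) {f f' : S} {c : ℕ}
    (hff' : f - f' ∈ Ideal.span (Set.range u) ^ c) {a : Fin N → ℕ} (hdeg : ∑ j, a j < c) :
    coeffClass u f a = coeffClass u f' a := by
  classical
  by_cases ha : a ∈ minExponents u f
  swap
  · have ha' : a ∉ minExponents u f' := fun h =>
      ha ((mem_minExponents_iff_of_sub_mem_pow u H hu hff' hdeg).mpr h)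
    rw [coeffClass_eq_zero_of_not_mem u ha, coeffClass_eq_zero_of_not_mem u ha']
  have ha' : a ∈ minExponents u f' := (mem_minExponents_iff_of_sub_mem_pow u H hu hff' hdeg).mp ha
  set A := minExponents u f with hAdef
  set A' := minExponents u f' with hA'def
  obtain ⟨hA, hfA, hminA⟩ := minExponents_spec' u H hu f
  obtain ⟨hA', hf'A', hminA'⟩ := minExponents_spec' u H hu f'
  obtain ⟨γ, hγ⟩ := exists_expansion_minExponents u hfA
  -- the low part of `A`, contained in `A'`
  set Alow := A.filter (fun b => ∑ j, b j < c) with hAlow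
  have hAlowA' : Alow ⊆ A' := by
    intro b hb
    obtain ⟨hbA, hbdeg⟩ := Finset.mem_filter.mp hb
    exact (mem_minExponents_iff_of_sub_mem_pow u H hu hff' hbdeg).mp hbA
  have haAlow : a ∈ Alow := Finset.mem_filter.mpr ⟨ha, hdeg⟩
  -- `R := f' - Σ_{Alow} γ_b u^b` lies in `(u^a' : a' ∈ A')` and in `(u)^c`
  set R := f' - ∑ b ∈ Alow, γ b * uPow u b with hR
  have hR1 : R ∈ Ideal.span (uPow u '' ↑A') := by
    refine sub_mem hf'A' (Submodule.sum_mem _ fun b hb => Ideal.mul_mem_left _ _ ?_)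
    exact uPow_mem_span_uPow u (Finset.mem_coe.mpr (hAlowA' hb))
  set E : Set (Fin N → ℕ) := {e | c ≤ ∑ l, e l} with hE
  have hR2 : R ∈ Ideal.span (uPow u '' E) := by
    have hsplit : f = (∑ b ∈ Alow, γ b * uPow u b) +
        ∑ b ∈ A.filter (fun b => ¬ ∑ j, b j < c), γ b * uPow u b := by
      rw [hγ, hAlow, Finset.sum_filter_add_sum_filter_not]
    have hrw : R = (∑ b ∈ A.filter (fun b => ¬ ∑ j, b j < c), γ b * uPow u b) - (f - f') := by
      rw [hR, hsplit]
      ring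
    rw [hrw, ← span_range_pow_eq_span_uPow]
    refine sub_mem (Submodule.sum_mem _ fun b hb => Ideal.mul_mem_left _ _ ?_) hff'
    have hbdeg : c ≤ ∑ j, b j := not_lt.mp (Finset.mem_filter.mp hb).2
    exact uPow_mem_span_pow u hbdeg
  -- hence in the monomial ideal of the sups `a'' ⊔ e`
  set W : Set (Fin N → ℕ) := Set.image2 (· ⊔ ·) (↑A' : Set (Fin N → ℕ)) E with hW
  have hRW : R ∈ Ideal.span (uPow u '' W) := by
    rw [hW, ← span_uPow_inf_span_uPow u H]
    exact ⟨hR1, hR2⟩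
  -- finitely many generators suffice
  obtain ⟨W₀, hW₀, -, hWeq⟩ := exists_finset_span_uPow_eq u W
  rw [hWeq] at hRW
  obtain ⟨κ, hκ⟩ := (Submodule.mem_span_image_finset_iff_exists_fun' (R := S)).mp hRW
  simp only [smul_eq_mul] at hκ
  -- each `w ∈ W₀` is `a'' ⊔ e`; record `σ w := a''`
  have hrep : ∀ w ∈ W₀, ∃ a'' ∈ A', a'' ≤ w ∧ c ≤ ∑ l, w l := by
    intro w hw
    obtain ⟨a'', ha'', e, he, rfl⟩ := hW₀ (Finset.mem_coe.mpr hw)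
    refine ⟨a'', Finset.mem_coe.mp ha'', le_sup_left, ?_⟩
    have he' : c ≤ ∑ l, e l := he
    exact he'.trans (Finset.sum_le_sum fun l _ => (le_sup_right : e ≤ a'' ⊔ e) l)
  choose! σ hσA' hσle hσdeg using hrep
  -- regroup the expansion of `R` over the fibres of `σ`
  set ρ : (Fin N → ℕ) → S := fun a'' =>
    ∑ w ∈ W₀.filter (fun w => σ w = a''), κ w * uPow u (w - σ w) with hρ
  have hRexp : R = ∑ a'' ∈ A', ρ a'' * uPow u a'' := by
    rw [← hκ]
    rw [← Finset.sum_fiberwise_of_maps_to (s := W₀) (t := A') (g := σ) (fun w hw => hσA' w hw)]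
    refine Finset.sum_congr rfl fun a'' _ => ?_
    rw [hρ, Finset.sum_mul]
    refine Finset.sum_congr rfl fun w hw => ?_
    obtain ⟨hwW, hσw⟩ := Finset.mem_filter.mp hw
    rw [mul_assoc, ← uPow_add, ← hσw, tsub_add_cancel_of_le (hσle w hwW)]
  -- the coefficient at `a` picks up only multiples of non-trivial monomials
  have hρa : ρ a ∈ Ideal.span (Set.range u) := by
    refine Submodule.sum_mem _ fun w hw => Ideal.mul_mem_left _ _ ?_
    obtain ⟨hwW, hσw⟩ := Finset.mem_filter.mp hw
    refine uPow_mem_span_range_of_ne_zero u fun hzero => ?_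
    have hwa : w = a := by
      have := tsub_add_cancel_of_le (hσle w hwW)
      rw [hzero, zero_add, hσw] at this
      exact this.symm
    have := hσdeg w hwW
    rw [hwa] at this
    omega
  -- the resulting expansion of `f'` over `A' = 𝐒(f')`
  set γ' : (Fin N → ℕ) → S := fun a'' => (if a'' ∈ Alow then γ a'' else 0) + ρ a'' with hγ'
  have hf'exp : f' = ∑ a'' ∈ A', γ' a'' * uPow u a'' := by
    have h1 : f' = (∑ b ∈ Alow, γ b * uPow u b) + R := by rw [hR]; ring
    nth_rewrite 1 [h1]
    rw [hRexp]
    simp only [hγ', add_mul, Finset.sum_add_distrib]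
    congr 1
    have : ∑ x ∈ A', (if x ∈ Alow then γ x else 0) * uPow u x =
        ∑ x ∈ A', (if x ∈ Alow then γ x * uPow u x else 0) := by
      refine Finset.sum_congr rfl fun x _ => ?_
      split_ifs <;> simp
    rw [this, Finset.sum_ite_mem, Finset.inter_eq_right.mpr hAlowA']
  rw [coeffClass_eq_mk u H hA hγ ha, coeffClass_eq_mk u H hA' hf'exp ha', Ideal.Quotient.eq]
  have : γ a - γ' a = -ρ a := by
    simp only [hγ', if_pos haAlow]
    ring
  rw [this]
  exact Submodule.neg_mem _ hρa


/-! ## (T′) Transfer of vertices and solvable vertices along coefficientwise congruences -/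

/-- `a / i = x` coordinatewise (in `ℝ`, `i ≥ 1`) forces `a = i • x`. [folklore] -/
private theorem eq_nsmul_of_div_natCast_eq {i : ℕ} (hi : 1 ≤ i) {a x : Fin N → ℕ}
    (h : (fun j => (a j : ℝ) / i) = fun j => (x j : ℝ)) : a = i • x := by
  have hipos : (0 : ℝ) < i := by exact_mod_cast hi
  funext j
  have hj : (a j : ℝ) / i = (x j : ℝ) := congrFun h j
  rw [div_eq_iff hipos.ne'] at hj
  have : (a j : ℝ) = ((i * x j : ℕ) : ℝ) := by rw [hj]; push_cast; ring
  have := (Nat.cast_inj (R := ℝ)).mp this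
  simpa [Pi.smul_apply, smul_eq_mul] using this

/-- Degree of a multiple: `Σ (k • x) = k Σ x`. [folklore] -/
private theorem sum_nsmul_eq (k : ℕ) (x : Fin N → ℕ) : ∑ j, (k • x) j = k * ∑ j, x j := by
  simp [Pi.smul_apply, smul_eq_mul, Finset.mul_sum]

/-- **A uniform weight bound**: for a positive weight vector `α`, an exponent `x` and a degree
`m`, beyond some total degree `c` every exponent `a` has `|a|_α > k |x|_α` for all `k ≤ m`, and
`m Σ x < c`. [folklore] -/
private theorem exists_degree_bound {α : Fin N → ℝ} (hα : ∀ j, 0 < α j) (x : Fin N → ℕ) (m : ℕ) :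
    ∃ c : ℕ, m * ∑ j, x j < c ∧
      ∀ a : Fin N → ℕ, c ≤ ∑ j, a j → ∀ k ∈ Finset.Icc 1 m, (k : ℝ) * weight α x < weight α a := by
  -- a positive lower bound for the weights
  obtain ⟨ε, hε, hεle⟩ : ∃ ε : ℝ, 0 < ε ∧ ∀ j, ε ≤ α j := by
    by_cases hN : Nonempty (Fin N)
    · obtain ⟨j₀, -, hj₀⟩ := Finset.exists_min_image Finset.univ α
        (Finset.univ_nonempty_iff.mpr hN)
      exact ⟨α j₀, hα j₀, fun j => hj₀ j (Finset.mem_univ j)⟩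
    · refine ⟨1, one_pos, fun j => ?_⟩
      exact absurd ⟨j⟩ hN
  have hwx : 0 ≤ weight α x := weight_nonneg (fun j => (hα j).le) x
  obtain ⟨c₀, hc₀⟩ := exists_nat_gt ((m : ℝ) * weight α x / ε)
  refine ⟨c₀ + m * ∑ j, x j + 1, by omega, fun a ha k hk => ?_⟩
  obtain ⟨hk1, hkm⟩ := Finset.mem_Icc.mp hk
  -- `weight α a ≥ ε Σ a ≥ ε c > m |x|_α ≥ k |x|_α`
  have h1 : ε * (∑ j, (a j : ℝ)) ≤ weight α a := by
    unfold weight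
    rw [Finset.mul_sum]
    exact Finset.sum_le_sum fun j _ => mul_le_mul_of_nonneg_right (hεle j) (Nat.cast_nonneg _)
  have h2 : (c₀ : ℝ) ≤ ∑ j, (a j : ℝ) := by
    have : ((c₀ + m * ∑ j, x j + 1 : ℕ) : ℝ) ≤ ((∑ j, a j : ℕ) : ℝ) := by exact_mod_cast ha
    push_cast at this
    have hnn : (0 : ℝ) ≤ (m : ℝ) * ∑ j, (x j : ℝ) := by positivity
    linarith
  have h3 : (m : ℝ) * weight α x < ε * c₀ := by
    rw [div_lt_iff₀ hε] at hc₀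
    linarith
  have h4 : (k : ℝ) * weight α x ≤ (m : ℝ) * weight α x :=
    mul_le_mul_of_nonneg_right (by exact_mod_cast hkm) hwx
  calc (k : ℝ) * weight α x ≤ (m : ℝ) * weight α x := h4
    _ < ε * c₀ := h3
    _ ≤ ε * ∑ j, (a j : ℝ) := mul_le_mul_of_nonneg_left h2 hε.le
    _ ≤ weight α a := h1

/-- **Transfer of a vertex**: if the coefficients of two monic polynomials of the same degree
`m` are congruent modulo `(u)^c`, with `c` beyond the degree bound of `exists_degree_bound` for
`(α, x, m)`, then `x` is an `α`-vertex of one iff of the other (one direction stated).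
[cite: CossartPiltant2019, Def. 2.2 (arXiv v1 p. 10)] -/
theorem IsVertexFor.of_coeff_sub_mem_pow [IsNoetherianRing S] [IsLocalRing S] {u : Fin N → S}
    (H : ∀ (i : Fin N) (T : Finset (Fin N)), i ∉ T →
      ∀ y, u i * y ∈ Ideal.span (u '' ↑T) → y ∈ Ideal.span (u '' ↑T))
    (hu : ∀ i, u i ∈ maximalIdeal S) {g g' : S[X]} (hdeg : g.natDegree = g'.natDegree)
    {c : ℕ} (hcoef : ∀ i, g.coeff i - g'.coeff i ∈ Ideal.span (Set.range u) ^ c)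
    {α : Fin N → ℝ} {x : Fin N → ℕ} (hsmall : g.natDegree * ∑ j, x j < c)
    (hbig : ∀ a : Fin N → ℕ, c ≤ ∑ j, a j →
      ∀ k ∈ Finset.Icc 1 g.natDegree, (k : ℝ) * weight α x < weight α a)
    (hx : IsVertexFor u g α (fun j => (x j : ℝ))) :
    IsVertexFor u g' α (fun j => (x j : ℝ)) := by
  obtain ⟨hall, i₀, hi₀, a₀, ha₀, hax⟩ := hx
  have hwx : ∑ j, α j * (x j : ℝ) = weight α x := rfl
  refine ⟨fun i hi a ha => ?_, ?_⟩
  · rw [← hdeg] at hi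
    have hipos : (0 : ℝ) < i := by exact_mod_cast (Finset.mem_Icc.mp hi).1
    by_cases hadeg : ∑ j, a j < c
    · -- a low generator of `g'` is one of `g`
      have ha' : a ∈ minExponents u (g.coeff (g.natDegree - i)) := by
        rw [hdeg]
        exact (mem_minExponents_iff_of_sub_mem_pow u H hu (hcoef _) hadeg).mpr ha
      exact hall i hi a ha'
    · -- a high generator is exposed strictly
      have hlt := hbig a (not_lt.mp hadeg) i hi
      rw [hwx]
      have hlt' : weight α x < weight α a / i := by
        rw [lt_div_iff₀ hipos, mul_comm]; exact hlt
      exact ⟨hlt'.le, fun heq => absurd heq hlt'.ne'⟩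
  · refine ⟨i₀, hdeg ▸ hi₀, a₀, ?_, hax⟩
    have hi1 : 1 ≤ i₀ := (Finset.mem_Icc.mp hi₀).1
    have ha₀x : a₀ = i₀ • x := eq_nsmul_of_div_natCast_eq hi1 hax
    have hadeg : ∑ j, a₀ j < c := by
      rw [ha₀x, sum_nsmul_eq]
      exact lt_of_le_of_lt (Nat.mul_le_mul_right _ (Finset.mem_Icc.mp hi₀).2) hsmall
    rw [← hdeg]
    exact (mem_minExponents_iff_of_sub_mem_pow u H hu (hcoef _) hadeg).mp ha₀

/-- **Transfer of a solvable vertex** along a coefficientwise congruence modulo `(u)^c`, `c`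
large for the exposing weight vector. [cite: CossartPiltant2019, Def. 2.3 (arXiv v1 p. 11)] -/
theorem isSolvableVertex_of_coeff_sub_mem_pow [IsNoetherianRing S] [IsLocalRing S]
    {u : Fin N → S}
    (H : ∀ (i : Fin N) (T : Finset (Fin N)), i ∉ T →
      ∀ y, u i * y ∈ Ideal.span (u '' ↑T) → y ∈ Ideal.span (u '' ↑T))
    (hu : ∀ i, u i ∈ maximalIdeal S) {g g' : S[X]} (hdeg : g.natDegree = g'.natDegree)
    {c : ℕ} (hcoef : ∀ i, g.coeff i - g'.coeff i ∈ Ideal.span (Set.range u) ^ c)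
    {α : Fin N → ℝ} (hα : ∀ j, 0 < α j) {x : Fin N → ℕ} (hsmall : g.natDegree * ∑ j, x j < c)
    (hbig : ∀ a : Fin N → ℕ, c ≤ ∑ j, a j →
      ∀ k ∈ Finset.Icc 1 g.natDegree, (k : ℝ) * weight α x < weight α a)
    (hvert : IsVertexFor u g α (fun j => (x j : ℝ)))
    (hsol : ∃ lam : S, ∀ i ∈ Finset.Icc 1 g.natDegree,
      coeffClass u (g.coeff (g.natDegree - i)) (i • x) =
        Ideal.Quotient.mk _ ((g.natDegree.choose i : S) * (-lam) ^ i)) :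
    IsSolvableVertex u g' x := by
  refine ⟨⟨α, hα, hvert.of_coeff_sub_mem_pow H hu hdeg hcoef hsmall hbig⟩, ?_⟩
  obtain ⟨lam, hlam⟩ := hsol
  refine ⟨lam, fun i hi => ?_⟩
  rw [← hdeg] at hi ⊢
  have hideg : ∑ j, (i • x) j < c := by
    rw [sum_nsmul_eq]
    exact lt_of_le_of_lt (Nat.mul_le_mul_right _ (Finset.mem_Icc.mp hi).2) hsmall
  rw [← coeffClass_eq_of_sub_mem_pow u H hu (hcoef _) hideg]
  exact hlam i hi

/-! ## (C) One dissolution step at a solvable vertex of least degree -/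

/-- **One step of Hironaka's vertex preparation**: for a monic `g`, a translation `X ↦ X + δ`
that does not enlarge `Δ`, and — if `g` has a solvable vertex — dissolves a solvable vertex `x`
of least degree, with `δ ∈ (u)^{Σ x}`; `δ = 0` if there is no solvable vertex.
[cite: CossartPiltant2019, Prop. 2.2 (arXiv v1 p. 11)] [cite: Hironaka1967, (3.10)] -/
theorem exists_dissolution_step [IsNoetherianRing S] [IsLocalRing S] (u : Fin N → S)
    (H : ∀ (i : Fin N) (T : Finset (Fin N)), i ∉ T →
      ∀ y, u i * y ∈ Ideal.span (u '' ↑T) → y ∈ Ideal.span (u '' ↑T))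
    (hu : ∀ i, u i ∈ maximalIdeal S) (g : S[X]) :
    ∃ δ : S, (g.Monic → charPolyhedron u (taylor δ g) ⊆ charPolyhedron u g) ∧
      ((g.Monic ∧ ∃ x, IsSolvableVertex u g x) →
        ∃ x, IsSolvableVertex u g x ∧
          (∀ x', IsSolvableVertex u g x' → ∑ j, x j ≤ ∑ j, x' j) ∧
          (fun j => (x j : ℝ)) ∉ charPolyhedron u (taylor δ g) ∧
          δ ∈ Ideal.span (Set.range u) ^ (∑ j, x j)) := by
  classical
  by_cases hex : g.Monic ∧ ∃ x, IsSolvableVertex u g x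
  · obtain ⟨hg, hex'⟩ := hex
    -- a solvable vertex of least degree
    have hP : ∃ d : ℕ, ∃ x, IsSolvableVertex u g x ∧ ∑ j, x j = d := by
      obtain ⟨x, hx⟩ := hex'
      exact ⟨_, x, hx, rfl⟩
    obtain ⟨x, hx, hxd⟩ := Nat.find_spec hP
    have hxmin : ∀ x', IsSolvableVertex u g x' → ∑ j, x j ≤ ∑ j, x' j := by
      intro x' hx'
      rw [hxd]
      exact Nat.find_min' hP ⟨x', hx', rfl⟩
    obtain ⟨lam, hlam⟩ := hx.not_mem_charPolyhedron_taylor H hu hg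
    have hxmem : (fun j => (x j : ℝ)) ∈ charPolyhedron u g := by
      obtain ⟨⟨α, -, hvert⟩, -⟩ := hx
      exact hvert.mem_charPolyhedron H hu
    refine ⟨lam * uPow u x, fun _ => charPolyhedron_taylor_subset u hg hxmem lam, fun _ =>
      ⟨x, hx, hxmin, hlam, ?_⟩⟩
    exact Ideal.mul_mem_left _ _ (uPow_mem_span_pow u le_rfl)
  · refine ⟨0, fun _ => ?_, fun h => absurd h hex⟩
    rw [taylor_zero]


/-! ## (C) The iteration, its `(u)`-adic convergence, and the minimality of the limit -/

/-- Coefficients of translates along congruent parameters are congruent: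
`θ - θ' ∈ J ⇒ coeff_i h(X + θ) - coeff_i h(X + θ') ∈ J`. [folklore] -/
private theorem taylor_coeff_sub_taylor_coeff_mem {J : Ideal S} {θ θ' : S} (hθ : θ - θ' ∈ J)
    (h : S[X]) (i : ℕ) : (taylor θ h).coeff i - (taylor θ' h).coeff i ∈ J := by
  rw [taylor_coeff, taylor_coeff]
  obtain ⟨q, hq⟩ := sub_dvd_eval_sub θ θ' (hasseDeriv i h)
  rw [hq]
  exact Ideal.mul_mem_right _ _ hθ

/-- **Hironaka's vertex preparation, existence** (Hironaka 1967, (3.10); Cossart–Piltant 2019,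
Prop. 2.2, first and second statements, in the language of Def. 2.4): over a Noetherian local ring
`S` which is (pre)complete for the `(u)`-adic topology, with `u₁, …, u_N ∈ m_S` satisfying (H)
(e.g. part of a regular system of parameters of a complete regular local ring), every monic
`h ∈ S[X]` has a translate `h(X + θ)`, `θ ∈ S`, whose polyhedron `Δ_S(h; u; X + θ)` has no solvable
vertex. Proof: dissolve a solvable vertex of least degree and repeat; the dissolved vertices are
pairwise distinct points of `ℕ^N`, so their degrees tend to infinity and the translation
parameters converge `(u)`-adically; a solvable vertex of the limit would, by truncation modulo
`(u)^c`, be a solvable vertex of a late stage of smaller degree than the vertex dissolved there.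
[cite: Hironaka1967, (3.10)] [cite: CossartPiltant2019, Prop. 2.2 and Def. 2.4 (arXiv v1 p. 11)] -/
theorem exists_isMinimal_taylor [IsNoetherianRing S] [IsLocalRing S] (u : Fin N → S)
    (H : ∀ (i : Fin N) (T : Finset (Fin N)), i ∉ T →
      ∀ y, u i * y ∈ Ideal.span (u '' ↑T) → y ∈ Ideal.span (u '' ↑T))
    (hu : ∀ i, u i ∈ maximalIdeal S) (hI : IsPrecomplete (Ideal.span (Set.range u)) S)
    {h : S[X]} (hh : h.Monic) : ∃ θ : S, IsMinimal u (taylor θ h) := by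
  classical
  -- the step function of `exists_dissolution_step`
  choose next hnext_sub hnext_spec using fun g => exists_dissolution_step u H hu g
  -- the translation parameters `θ_k` (partial sums of the steps)
  let θ : ℕ → S := fun k => Nat.rec (motive := fun _ => S) 0 (fun _ θk => θk + next (taylor θk h)) k
  have hθsucc : ∀ k, θ (k + 1) = θ k + next (taylor (θ k) h) := fun k => rfl
  have hmonic : ∀ k, (taylor (θ k) h).Monic := fun k => by
    rw [Monic, leadingCoeff_taylor]; exact hh
  have hsucc : ∀ k, taylor (θ (k + 1)) h = taylor (next (taylor (θ k) h)) (taylor (θ k) h) := by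
    intro k
    rw [taylor_taylor, hθsucc, add_comm]
  -- `Δ` decreases along the sequence
  have hanti : ∀ j k, j ≤ k →
      charPolyhedron u (taylor (θ k) h) ⊆ charPolyhedron u (taylor (θ j) h) := by
    intro j k hjk
    induction k, hjk using Nat.le_induction with
    | base => exact subset_rfl
    | succ k _ ih =>
      rw [hsucc k]
      exact (hnext_sub _ (hmonic k)).trans ih
  -- if some stage has no solvable vertex, we are done
  by_cases hstop : ∃ k, ¬ ∃ x, IsSolvableVertex u (taylor (θ k) h) x
  · obtain ⟨k, hk⟩ := hstop
    exact ⟨θ k, fun x hx => hk ⟨x, hx⟩⟩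
  push Not at hstop
  -- otherwise: the dissolved vertices `xs k`
  have hxs : ∀ k, ∃ x, IsSolvableVertex u (taylor (θ k) h) x ∧
      (∀ x', IsSolvableVertex u (taylor (θ k) h) x' → ∑ j, x j ≤ ∑ j, x' j) ∧
      (fun j => (x j : ℝ)) ∉ charPolyhedron u (taylor (θ (k + 1)) h) ∧
      next (taylor (θ k) h) ∈ Ideal.span (Set.range u) ^ (∑ j, x j) := by
    intro k
    obtain ⟨x, hx, hmin, hnot, hmem⟩ := hnext_spec _ ⟨hmonic k, hstop k⟩
    refine ⟨x, hx, hmin, ?_, hmem⟩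
    rwa [hsucc k]
  choose xs hxs_sol hxs_min hxs_not hxs_mem using hxs
  -- they are pairwise distinct
  have hne : ∀ j k, j < k → xs j ≠ xs k := by
    intro j k hjk heq
    have hmemk : (fun l => (xs k l : ℝ)) ∈ charPolyhedron u (taylor (θ k) h) := by
      obtain ⟨⟨α, -, hvert⟩, -⟩ := hxs_sol k
      exact hvert.mem_charPolyhedron H hu
    have hmemj := hanti (j + 1) k hjk hmemk
    rw [← heq] at hmemj
    exact hxs_not j hmemj
  have hinj : Function.Injective xs := by
    intro j k heq
    rcases lt_trichotomy j k with hlt | rfl | hgt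
    · exact absurd heq (hne j k hlt)
    · rfl
    · exact absurd heq.symm (hne k j hgt)
  -- hence their degrees tend to infinity
  have htend : ∀ B : ℕ, ∃ K, ∀ k, K ≤ k → B < ∑ j, xs k j := by
    intro B
    have hfin : {y : Fin N → ℕ | ∑ j, y j ≤ B}.Finite := by
      refine (Finset.Iic (fun _ : Fin N => B)).finite_toSet.subset fun y hy => ?_
      rw [Finset.mem_coe, Finset.mem_Iic]
      intro j
      have hy' : ∑ j, y j ≤ B := hy
      exact le_trans (Finset.single_le_sum (fun i _ => Nat.zero_le (y i)) (Finset.mem_univ j)) hy'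
    have hfin' : (xs ⁻¹' {y : Fin N → ℕ | ∑ j, y j ≤ B}).Finite := hfin.preimage hinj.injOn
    obtain ⟨K, hK⟩ := hfin'.bddAbove
    refine ⟨K + 1, fun k hk => ?_⟩
    by_contra hle
    push Not at hle
    have : k ≤ K := hK (show k ∈ xs ⁻¹' {y : Fin N → ℕ | ∑ j, y j ≤ B} from hle)
    omega
  -- telescoping: `θ k' - θ k ∈ (u)^n` once all degrees from `K` on are `≥ n`
  set I := Ideal.span (Set.range u) with hIdef
  have htel : ∀ n K, (∀ k, K ≤ k → n ≤ ∑ j, xs k j) →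
      ∀ k k', K ≤ k → k ≤ k' → θ k' - θ k ∈ I ^ n := by
    intro n K hK k k' hKk hkk'
    induction k', hkk' using Nat.le_induction with
    | base => simp
    | succ k' hkk' ih =>
      have hrw : θ (k' + 1) - θ k = (θ k' - θ k) + next (taylor (θ k') h) := by
        rw [hθsucc]; ring
      rw [hrw]
      exact add_mem ih (Ideal.pow_le_pow_right (hK k' (hKk.trans hkk')) (hxs_mem k'))
  -- a monotone modulus
  choose K0 hK0 using htend
  let Kf : ℕ → ℕ := fun n => (Finset.range (n + 1)).sup K0
  have hKmono : Monotone Kf := fun a b hab =>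
    Finset.sup_mono (Finset.range_mono (by omega))
  have hKf : ∀ n k, Kf n ≤ k → n ≤ ∑ j, xs k j := by
    intro n k hk
    have : K0 n ≤ k :=
      le_trans (Finset.le_sup (f := K0) (Finset.mem_range.mpr (Nat.lt_succ_self n))) hk
    exact (hK0 n k this).le
  -- the Cauchy sequence `θ (Kf n)` and its limit `L`
  have hcauchy : ∀ {m n : ℕ}, m ≤ n →
      θ (Kf m) ≡ θ (Kf n) [SMOD (I ^ m • ⊤ : Submodule S S)] := by
    intro m n hmn
    rw [SModEq.sub_mem, Ideal.smul_eq_mul, Ideal.mul_top, ← neg_sub]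
    exact Submodule.neg_mem _ (htel m (Kf m) (hKf m) (Kf m) (Kf n) le_rfl (hKmono hmn))
  obtain ⟨L, hL⟩ := hI.prec hcauchy
  have hlim : ∀ n k, Kf n ≤ k → L - θ k ∈ I ^ n := by
    intro n k hk
    have h1 : θ (Kf n) - L ∈ I ^ n := by
      have := hL n
      rwa [SModEq.sub_mem, Ideal.smul_eq_mul, Ideal.mul_top] at this
    have h2 : θ k - θ (Kf n) ∈ I ^ n := htel n (Kf n) (hKf n) (Kf n) k le_rfl hk
    have hrw : L - θ k = -((θ k - θ (Kf n)) + (θ (Kf n) - L)) := by ring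
    rw [hrw]
    exact Submodule.neg_mem _ (add_mem h2 h1)
  -- the limit translate has no solvable vertex
  refine ⟨L, fun x hx => ?_⟩
  obtain ⟨⟨α, hα, hvert⟩, hsol⟩ := hx
  obtain ⟨c, hcsmall, hcbig⟩ := exists_degree_bound hα x (taylor L h).natDegree
  set K₂ := K0 (∑ j, x j) with hK₂def
  have hK₂ := hK0 (∑ j, x j)
  set k := max (Kf c) K₂ with hkdef
  have hcoef : ∀ i, (taylor L h).coeff i - (taylor (θ k) h).coeff i ∈ I ^ c :=
    fun i => taylor_coeff_sub_taylor_coeff_mem (hlim c k (le_max_left _ _)) h i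
  have hdeg : (taylor L h).natDegree = (taylor (θ k) h).natDegree := by
    rw [natDegree_taylor, natDegree_taylor]
  have hsolk : IsSolvableVertex u (taylor (θ k) h) x :=
    isSolvableVertex_of_coeff_sub_mem_pow H hu hdeg hcoef hα hcsmall hcbig hvert hsol
  have h1 := hxs_min k x hsolk
  have h2 := hK₂ k (le_max_right _ _)
  omega


/-! ## Complete local rings are `(u)`-adically precomplete -/

/-- In a Noetherian local ring which is `J`-adically complete (`J ≠ S`), every smaller ideal
`I ≤ J` also has the Cauchy-completeness property (`IsPrecomplete I S`): an `I`-adic Cauchy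
sequence is `J`-adically Cauchy, and its `J`-adic limit is an `I`-adic limit by Krull's
intersection theorem in the finite `S`-modules `S ⧸ Iⁿ` (`⋂ₖ (Iⁿ + Jᵏ) = Iⁿ`).
[cite: Matsumura1987, Thm. 8.10 (Krull) and §8] -/
theorem isPrecomplete_of_le_of_isAdicComplete [IsNoetherianRing S] [IsLocalRing S] {I J : Ideal S}
    (hIJ : I ≤ J) (hJ : J ≠ ⊤) [IsAdicComplete J S] : IsPrecomplete I S := by
  refine ⟨fun f hf => ?_⟩
  have hfJ : ∀ {m n : ℕ}, m ≤ n → f m ≡ f n [SMOD (J ^ m • ⊤ : Submodule S S)] := by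
    intro m n hmn
    have := hf hmn
    rw [SModEq.sub_mem, Ideal.smul_eq_mul, Ideal.mul_top] at this ⊢
    exact Ideal.pow_right_mono hIJ m this
  obtain ⟨L, hL⟩ := IsPrecomplete.prec (inferInstance : IsPrecomplete J S) hfJ
  refine ⟨L, fun n => ?_⟩
  rw [SModEq.sub_mem, Ideal.smul_eq_mul, Ideal.mul_top]
  -- `f n - L ∈ Iⁿ + Jᵏ` for every `k`
  have hmem : ∀ k, f n - L ∈ I ^ n ⊔ J ^ k := by
    intro k
    have h1 : f n - f (max n k) ∈ I ^ n := by
      have := hf (le_max_left n k)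
      rwa [SModEq.sub_mem, Ideal.smul_eq_mul, Ideal.mul_top] at this
    have h2 : f (max n k) - L ∈ J ^ k := by
      have := hL (max n k)
      rw [SModEq.sub_mem, Ideal.smul_eq_mul, Ideal.mul_top] at this
      exact Ideal.pow_le_pow_right (le_max_right n k) this
    have hrw : f n - L = (f n - f (max n k)) + (f (max n k) - L) := by ring
    rw [hrw]
    exact add_mem (Ideal.mem_sup_left h1) (Ideal.mem_sup_right h2)
  -- Krull's intersection theorem in `S ⧸ Iⁿ`
  set x := f n - L with hxdef
  have hbar : ∀ k, (Submodule.Quotient.mk x : S ⧸ I ^ n) ∈ (J ^ k • ⊤ : Submodule S (S ⧸ I ^ n)) := by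
    intro k
    obtain ⟨y, hy, z, hz, hyz⟩ := Submodule.mem_sup.mp (hmem k)
    have : (Submodule.Quotient.mk x : S ⧸ I ^ n) = z • Submodule.Quotient.mk (1 : S) := by
      rw [← hyz, Submodule.Quotient.mk_add, (Submodule.Quotient.mk_eq_zero _).mpr hy, zero_add,
        ← Submodule.Quotient.mk_smul, smul_eq_mul, mul_one]
    rw [this]
    exact Submodule.smul_mem_smul hz Submodule.mem_top
  have hKrull : (⨅ k : ℕ, J ^ k • ⊤ : Submodule S (S ⧸ I ^ n)) = ⊥ :=
    Ideal.iInf_pow_smul_eq_bot_of_isLocalRing (I := J) (M := S ⧸ I ^ n) hJ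
  have hzero : (Submodule.Quotient.mk x : S ⧸ I ^ n) = 0 := by
    rw [← Submodule.mem_bot S, ← hKrull, Submodule.mem_iInf]
    exact hbar
  exact (Submodule.Quotient.mk_eq_zero _).mp hzero

/-- **Hironaka's vertex preparation in a complete local ring**: `S` Noetherian local and
`m_S`-adically complete, `u₁, …, u_N ∈ m_S` with (H) (e.g. a regular system of parameters, or part
of one, of a complete regular local ring), `h ∈ S[X]` monic ⇒ some translate `h(X + θ)`, `θ ∈ S`,
has a polyhedron `Δ_S(h; u; X + θ)` without solvable vertices (`IsMinimal`, Def. 2.4).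
[cite: Hironaka1967, (3.10)] [cite: CossartPiltant2019, Prop. 2.2 and Def. 2.4 (arXiv v1 p. 11)] -/
theorem exists_isMinimal_taylor_of_isAdicComplete [IsNoetherianRing S] [IsLocalRing S]
    [IsAdicComplete (maximalIdeal S) S] (u : Fin N → S)
    (H : ∀ (i : Fin N) (T : Finset (Fin N)), i ∉ T →
      ∀ y, u i * y ∈ Ideal.span (u '' ↑T) → y ∈ Ideal.span (u '' ↑T))
    (hu : ∀ i, u i ∈ maximalIdeal S) {h : S[X]} (hh : h.Monic) :
    ∃ θ : S, IsMinimal u (taylor θ h) :=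
  exists_isMinimal_taylor u H hu
    (isPrecomplete_of_le_of_isAdicComplete
      (Ideal.span_le.mpr (Set.range_subset_iff.mpr hu)) (maximalIdeal.isMaximal S).ne_top) hh

/-- The same with the translation written as a composition `h(X + θ) = h.comp (X + C θ)`.
[cite: Hironaka1967, (3.10)] [cite: CossartPiltant2019, Prop. 2.2 and Def. 2.4 (arXiv v1 p. 11)] -/
theorem exists_isMinimal_comp_X_add_C [IsNoetherianRing S] [IsLocalRing S]
    [IsAdicComplete (maximalIdeal S) S] (u : Fin N → S)
    (H : ∀ (i : Fin N) (T : Finset (Fin N)), i ∉ T →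
      ∀ y, u i * y ∈ Ideal.span (u '' ↑T) → y ∈ Ideal.span (u '' ↑T))
    (hu : ∀ i, u i ∈ maximalIdeal S) {h : S[X]} (hh : h.Monic) :
    ∃ θ : S, IsMinimal u (h.comp (X + C θ)) := by
  obtain ⟨θ, hθ⟩ := exists_isMinimal_taylor_of_isAdicComplete u H hu hh
  exact ⟨θ, by rwa [taylor_apply] at hθ⟩


/-! ## Refinement: the preparing translation lies in `I_α(q)` whenever `δ_α(h; u; X) ≥ q`

Cossart–Piltant 2019, §2.3 (arXiv v1 p. 15): "By minimality, we have `μ_α(φ) ≥ a := δ_α(h; u; Z)`"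
— a translation between prepared coordinates has valuation at least `δ_α`. The constructive proof
of (3.10) gives the corresponding statement for the preparing translation itself: every step
`X ↦ X + λ u^x` dissolves a vertex `x ∈ Δ_S(h; u; X)`, so `u^x ∈ I_α(q)` as soon as
`δ_α(h; u; X) ≥ q` (`α ≥ 0`), and `I_α(q)` is closed under `(u)`-adic limits. -/

/-- An ideal of a Noetherian local ring is closed for the `J`-adic topology, `J ≠ S`:
`(∀ n, x ∈ 𝔞 + Jⁿ) ⇒ x ∈ 𝔞` (Krull's intersection theorem in `S ⧸ 𝔞`).
[cite: Matsumura1987, Thm. 8.10] -/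
theorem mem_of_forall_mem_sup_pow [IsNoetherianRing S] [IsLocalRing S] {𝔞 J : Ideal S}
    (hJ : J ≠ ⊤) {x : S} (hx : ∀ n : ℕ, x ∈ 𝔞 ⊔ J ^ n) : x ∈ 𝔞 := by
  have hbar : ∀ k, (Submodule.Quotient.mk x : S ⧸ 𝔞) ∈ (J ^ k • ⊤ : Submodule S (S ⧸ 𝔞)) := by
    intro k
    obtain ⟨y, hy, z, hz, hyz⟩ := Submodule.mem_sup.mp (hx k)
    have : (Submodule.Quotient.mk x : S ⧸ 𝔞) = z • Submodule.Quotient.mk (1 : S) := by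
      rw [← hyz, Submodule.Quotient.mk_add, (Submodule.Quotient.mk_eq_zero _).mpr hy, zero_add,
        ← Submodule.Quotient.mk_smul, smul_eq_mul, mul_one]
    rw [this]
    exact Submodule.smul_mem_smul hz Submodule.mem_top
  have hKrull : (⨅ k : ℕ, J ^ k • ⊤ : Submodule S (S ⧸ 𝔞)) = ⊥ :=
    Ideal.iInf_pow_smul_eq_bot_of_isLocalRing (I := J) (M := S ⧸ 𝔞) hJ
  have hzero : (Submodule.Quotient.mk x : S ⧸ 𝔞) = 0 := by
    rw [← Submodule.mem_bot S, ← hKrull, Submodule.mem_iInf]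
    exact hbar
  exact (Submodule.Quotient.mk_eq_zero _).mp hzero

/-- **A vertex of `Δ_S(h; u; X)` has `α₀`-weight `≥ q₀` whenever `δ_{α₀}(h; u; X) ≥ q₀`**
(`α₀ ≥ 0`, possibly with zero entries): the vertex is a generating point `a / i`,
`a ∈ 𝐒(f_{i,X})`, and `f_{i,X} ∈ I_{α₀}(i q₀)` forces `|a|_{α₀} ≥ i q₀` by minimality of `𝐒`.
[cite: CossartPiltant2019, Def. 2.1–2.2 (arXiv v1 p. 10)] -/
theorem IsVertexFor.le_weight_of_deltaGE [IsNoetherianRing S] [IsLocalRing S] {u : Fin N → S}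
    (H : ∀ (i : Fin N) (T : Finset (Fin N)), i ∉ T →
      ∀ y, u i * y ∈ Ideal.span (u '' ↑T) → y ∈ Ideal.span (u '' ↑T))
    (hu : ∀ i, u i ∈ maximalIdeal S) {g : S[X]} {α : Fin N → ℝ} {x : Fin N → ℕ}
    (hx : IsVertexFor u g α (fun j => (x j : ℝ))) {α₀ : Fin N → ℝ} (hα₀ : ∀ j, 0 ≤ α₀ j)
    {q₀ : ℝ} (hΔ : DeltaGE u α₀ g q₀) : q₀ ≤ weight α₀ x := by
  obtain ⟨-, i, hi, a, ha, hax⟩ := hx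
  have hi1 : 1 ≤ i := (Finset.mem_Icc.mp hi).1
  have hipos : (0 : ℝ) < i := by exact_mod_cast hi1
  have hax' : a = i • x := eq_nsmul_of_div_natCast_eq hi1 hax
  have hspec := fun k => minExponents_spec' u H hu (g.coeff (g.natDegree - k))
  have key := (deltaGE_iff_of_minimal u hα₀ (h := g)
    (fun k => minExponents u (g.coeff (g.natDegree - k))) (fun k _ => (hspec k).2.1)
    (fun k _ => (hspec k).2.2)).mp hΔ i hi a ha
  rw [hax', weight_nsmul] at key
  exact le_of_mul_le_mul_left key hipos

/-- **One step, with the dissolving translation made explicit** (`δ = λ u^x`).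
[cite: CossartPiltant2019, Prop. 2.2 (arXiv v1 p. 11)] [cite: Hironaka1967, (3.10)] -/
theorem exists_dissolution_step_mul [IsNoetherianRing S] [IsLocalRing S] (u : Fin N → S)
    (H : ∀ (i : Fin N) (T : Finset (Fin N)), i ∉ T →
      ∀ y, u i * y ∈ Ideal.span (u '' ↑T) → y ∈ Ideal.span (u '' ↑T))
    (hu : ∀ i, u i ∈ maximalIdeal S) (g : S[X]) :
    ∃ δ : S, (g.Monic → charPolyhedron u (taylor δ g) ⊆ charPolyhedron u g) ∧
      ((g.Monic ∧ ∃ x, IsSolvableVertex u g x) →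
        ∃ x, IsSolvableVertex u g x ∧
          (∀ x', IsSolvableVertex u g x' → ∑ j, x j ≤ ∑ j, x' j) ∧
          (fun j => (x j : ℝ)) ∉ charPolyhedron u (taylor δ g) ∧
          ∃ lam : S, δ = lam * uPow u x) ∧
      ((¬ (g.Monic ∧ ∃ x, IsSolvableVertex u g x)) → δ = 0) := by
  classical
  by_cases hex : g.Monic ∧ ∃ x, IsSolvableVertex u g x
  · obtain ⟨hg, hex'⟩ := hex
    have hP : ∃ d : ℕ, ∃ x, IsSolvableVertex u g x ∧ ∑ j, x j = d := by
      obtain ⟨x, hx⟩ := hex'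
      exact ⟨_, x, hx, rfl⟩
    obtain ⟨x, hx, hxd⟩ := Nat.find_spec hP
    have hxmin : ∀ x', IsSolvableVertex u g x' → ∑ j, x j ≤ ∑ j, x' j := by
      intro x' hx'
      rw [hxd]
      exact Nat.find_min' hP ⟨x', hx', rfl⟩
    obtain ⟨lam, hlam⟩ := hx.not_mem_charPolyhedron_taylor H hu hg
    have hxmem : (fun j => (x j : ℝ)) ∈ charPolyhedron u g := by
      obtain ⟨⟨α, -, hvert⟩, -⟩ := hx
      exact hvert.mem_charPolyhedron H hu
    exact ⟨lam * uPow u x, fun _ => charPolyhedron_taylor_subset u hg hxmem lam, fun _ =>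
      ⟨x, hx, hxmin, hlam, lam, rfl⟩, fun h => absurd ⟨hg, hex'⟩ h⟩
  · refine ⟨0, fun _ => ?_, fun h => absurd h hex, fun _ => rfl⟩
    rw [taylor_zero]

/-- **Hironaka's vertex preparation with control of the translation**: under the hypotheses of
`exists_isMinimal_taylor`, if moreover `δ_{α₀}(h; u; X) ≥ q₀` for some `α₀ ≥ 0` (i.e.
`f_{i,X} ∈ I_{α₀}(i q₀)` for all `i`), then the preparing translation can be taken with
`θ ∈ I_{α₀}(q₀)` — every dissolved vertex lies in `Δ`, hence has `α₀`-weight `≥ q₀`, and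
`I_{α₀}(q₀)` is `(u)`-adically closed. In particular (by `DeltaGE.taylor`) `δ_{α₀} ≥ q₀` persists
for the prepared `h(X + θ)`. With `α₀ = 𝟙_J`, `q₀ = 1` this says: if `Δ_S(h; u; X) ⊆
{Σ_{j ∈ J} x_j ≥ 1}` then `θ ∈ (u_j : j ∈ J)` and the prepared polyhedron stays there.
[cite: CossartPiltant2019, Prop. 2.2–2.3 and §2.3 (arXiv v1 pp. 11–12, 15)] [cite: Hironaka1967, (3.10)] -/
theorem exists_mem_isMinimal_taylor [IsNoetherianRing S] [IsLocalRing S] (u : Fin N → S)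
    (H : ∀ (i : Fin N) (T : Finset (Fin N)), i ∉ T →
      ∀ y, u i * y ∈ Ideal.span (u '' ↑T) → y ∈ Ideal.span (u '' ↑T))
    (hu : ∀ i, u i ∈ maximalIdeal S) (hI : IsPrecomplete (Ideal.span (Set.range u)) S)
    {h : S[X]} (hh : h.Monic) {α₀ : Fin N → ℝ} (hα₀ : ∀ j, 0 ≤ α₀ j) {q₀ : ℝ}
    (hΔ : DeltaGE u α₀ h q₀) :
    ∃ θ ∈ monomialIdeal u α₀ q₀, IsMinimal u (taylor θ h) := by
  classical
  choose next hnext_sub hnext_spec hnext_zero using fun g => exists_dissolution_step_mul u H hu g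
  let θ : ℕ → S := fun k => Nat.rec (motive := fun _ => S) 0 (fun _ θk => θk + next (taylor θk h)) k
  have hθzero : θ 0 = 0 := rfl
  have hθsucc : ∀ k, θ (k + 1) = θ k + next (taylor (θ k) h) := fun k => rfl
  have hmonic : ∀ k, (taylor (θ k) h).Monic := fun k => by
    rw [Monic, leadingCoeff_taylor]; exact hh
  have hsucc : ∀ k, taylor (θ (k + 1)) h = taylor (next (taylor (θ k) h)) (taylor (θ k) h) := by
    intro k
    rw [taylor_taylor, hθsucc, add_comm]
  have hanti : ∀ j k, j ≤ k →
      charPolyhedron u (taylor (θ k) h) ⊆ charPolyhedron u (taylor (θ j) h) := by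
    intro j k hjk
    induction k, hjk using Nat.le_induction with
    | base => exact subset_rfl
    | succ k _ ih =>
      rw [hsucc k]
      exact (hnext_sub _ (hmonic k)).trans ih
  -- the invariant: `θ k ∈ I_{α₀}(q₀)` and `δ_{α₀}(h(X + θ k)) ≥ q₀`
  have hinv : ∀ k, θ k ∈ monomialIdeal u α₀ q₀ ∧ DeltaGE u α₀ (taylor (θ k) h) q₀ := by
    intro k
    induction k with
    | zero =>
      refine ⟨by rw [hθzero]; exact Submodule.zero_mem _, ?_⟩
      rw [hθzero, taylor_zero]
      exact hΔ
    | succ k ih =>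
      obtain ⟨hθk, hΔk⟩ := ih
      -- the increment lies in `I_{α₀}(q₀)`
      have hincr : next (taylor (θ k) h) ∈ monomialIdeal u α₀ q₀ := by
        by_cases hex : (taylor (θ k) h).Monic ∧ ∃ x, IsSolvableVertex u (taylor (θ k) h) x
        · obtain ⟨x, hx, -, -, lam, hlam⟩ := hnext_spec _ hex
          obtain ⟨⟨α, -, hvert⟩, -⟩ := hx
          have hw := hvert.le_weight_of_deltaGE H hu hα₀ hΔk
          rw [hlam]
          exact Ideal.mul_mem_left _ _ (uPow_mem_monomialIdeal u hw)
        · rw [hnext_zero _ hex]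
          exact Submodule.zero_mem _
      refine ⟨?_, ?_⟩
      · rw [hθsucc]
        exact add_mem hθk hincr
      · rw [hsucc k]
        exact DeltaGE.taylor (hmonic k) hincr hΔk
  by_cases hstop : ∃ k, ¬ ∃ x, IsSolvableVertex u (taylor (θ k) h) x
  · obtain ⟨k, hk⟩ := hstop
    exact ⟨θ k, (hinv k).1, fun x hx => hk ⟨x, hx⟩⟩
  push Not at hstop
  have hxs : ∀ k, ∃ x, IsSolvableVertex u (taylor (θ k) h) x ∧
      (∀ x', IsSolvableVertex u (taylor (θ k) h) x' → ∑ j, x j ≤ ∑ j, x' j) ∧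
      (fun j => (x j : ℝ)) ∉ charPolyhedron u (taylor (θ (k + 1)) h) ∧
      next (taylor (θ k) h) ∈ Ideal.span (Set.range u) ^ (∑ j, x j) := by
    intro k
    obtain ⟨x, hx, hmin, hnot, lam, hlam⟩ := hnext_spec _ ⟨hmonic k, hstop k⟩
    refine ⟨x, hx, hmin, ?_, ?_⟩
    · rwa [hsucc k]
    · rw [hlam]
      exact Ideal.mul_mem_left _ _ (uPow_mem_span_pow u le_rfl)
  choose xs hxs_sol hxs_min hxs_not hxs_mem using hxs
  have hne : ∀ j k, j < k → xs j ≠ xs k := by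
    intro j k hjk heq
    have hmemk : (fun l => (xs k l : ℝ)) ∈ charPolyhedron u (taylor (θ k) h) := by
      obtain ⟨⟨α, -, hvert⟩, -⟩ := hxs_sol k
      exact hvert.mem_charPolyhedron H hu
    have hmemj := hanti (j + 1) k hjk hmemk
    rw [← heq] at hmemj
    exact hxs_not j hmemj
  have hinj : Function.Injective xs := by
    intro j k heq
    rcases lt_trichotomy j k with hlt | rfl | hgt
    · exact absurd heq (hne j k hlt)
    · rfl
    · exact absurd heq.symm (hne k j hgt)
  have htend : ∀ B : ℕ, ∃ K, ∀ k, K ≤ k → B < ∑ j, xs k j := by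
    intro B
    have hfin : {y : Fin N → ℕ | ∑ j, y j ≤ B}.Finite := by
      refine (Finset.Iic (fun _ : Fin N => B)).finite_toSet.subset fun y hy => ?_
      rw [Finset.mem_coe, Finset.mem_Iic]
      intro j
      have hy' : ∑ j, y j ≤ B := hy
      exact le_trans (Finset.single_le_sum (fun i _ => Nat.zero_le (y i)) (Finset.mem_univ j)) hy'
    have hfin' : (xs ⁻¹' {y : Fin N → ℕ | ∑ j, y j ≤ B}).Finite := hfin.preimage hinj.injOn
    obtain ⟨K, hK⟩ := hfin'.bddAbove
    refine ⟨K + 1, fun k hk => ?_⟩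
    by_contra hle
    push Not at hle
    have : k ≤ K := hK (show k ∈ xs ⁻¹' {y : Fin N → ℕ | ∑ j, y j ≤ B} from hle)
    omega
  set I := Ideal.span (Set.range u) with hIdef
  have htel : ∀ n K, (∀ k, K ≤ k → n ≤ ∑ j, xs k j) →
      ∀ k k', K ≤ k → k ≤ k' → θ k' - θ k ∈ I ^ n := by
    intro n K hK k k' hKk hkk'
    induction k', hkk' using Nat.le_induction with
    | base => simp
    | succ k' hkk' ih =>
      have hrw : θ (k' + 1) - θ k = (θ k' - θ k) + next (taylor (θ k') h) := by
        rw [hθsucc]; ring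
      rw [hrw]
      exact add_mem ih (Ideal.pow_le_pow_right (hK k' (hKk.trans hkk')) (hxs_mem k'))
  choose K0 hK0 using htend
  let Kf : ℕ → ℕ := fun n => (Finset.range (n + 1)).sup K0
  have hKmono : Monotone Kf := fun a b hab =>
    Finset.sup_mono (Finset.range_mono (by omega))
  have hKf : ∀ n k, Kf n ≤ k → n ≤ ∑ j, xs k j := by
    intro n k hk
    have : K0 n ≤ k :=
      le_trans (Finset.le_sup (f := K0) (Finset.mem_range.mpr (Nat.lt_succ_self n))) hk
    exact (hK0 n k this).le
  have hcauchy : ∀ {m n : ℕ}, m ≤ n →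
      θ (Kf m) ≡ θ (Kf n) [SMOD (I ^ m • ⊤ : Submodule S S)] := by
    intro m n hmn
    rw [SModEq.sub_mem, Ideal.smul_eq_mul, Ideal.mul_top, ← neg_sub]
    exact Submodule.neg_mem _ (htel m (Kf m) (hKf m) (Kf m) (Kf n) le_rfl (hKmono hmn))
  obtain ⟨L, hL⟩ := hI.prec hcauchy
  have hlim : ∀ n k, Kf n ≤ k → L - θ k ∈ I ^ n := by
    intro n k hk
    have h1 : θ (Kf n) - L ∈ I ^ n := by
      have := hL n
      rwa [SModEq.sub_mem, Ideal.smul_eq_mul, Ideal.mul_top] at this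
    have h2 : θ k - θ (Kf n) ∈ I ^ n := htel n (Kf n) (hKf n) (Kf n) k le_rfl hk
    have hrw : L - θ k = -((θ k - θ (Kf n)) + (θ (Kf n) - L)) := by ring
    rw [hrw]
    exact Submodule.neg_mem _ (add_mem h2 h1)
  -- the limit lies in the closed ideal `I_{α₀}(q₀)`
  have hLmem : L ∈ monomialIdeal u α₀ q₀ := by
    have hItop : I ≠ ⊤ :=
      ne_top_of_le_ne_top (maximalIdeal.isMaximal S).ne_top
        (Ideal.span_le.mpr (Set.range_subset_iff.mpr hu))
    refine mem_of_forall_mem_sup_pow (J := I) hItop fun n => ?_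
    have hrw : L = θ (Kf n) + (L - θ (Kf n)) := by ring
    rw [hrw]
    exact add_mem (Ideal.mem_sup_left (hinv _).1) (Ideal.mem_sup_right (hlim n _ le_rfl))
  refine ⟨L, hLmem, fun x hx => ?_⟩
  obtain ⟨⟨α, hα, hvert⟩, hsol⟩ := hx
  obtain ⟨c, hcsmall, hcbig⟩ := exists_degree_bound hα x (taylor L h).natDegree
  set K₂ := K0 (∑ j, x j) with hK₂def
  have hK₂ := hK0 (∑ j, x j)
  set k := max (Kf c) K₂ with hkdef
  have hcoef : ∀ i, (taylor L h).coeff i - (taylor (θ k) h).coeff i ∈ I ^ c :=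
    fun i => taylor_coeff_sub_taylor_coeff_mem (hlim c k (le_max_left _ _)) h i
  have hdeg : (taylor L h).natDegree = (taylor (θ k) h).natDegree := by
    rw [natDegree_taylor, natDegree_taylor]
  have hsolk : IsSolvableVertex u (taylor (θ k) h) x :=
    isSolvableVertex_of_coeff_sub_mem_pow H hu hdeg hcoef hα hcsmall hcbig hvert hsol
  have h1 := hxs_min k x hsolk
  have h2 := hK₂ k (le_max_right _ _)
  omega


/-- **Vertex preparation inside `I_α(q)` in a complete local ring**: `S` Noetherian local and
`m_S`-adically complete, `u ⊆ m_S` with (H), `h` monic with `δ_{α₀}(h; u; X) ≥ q₀` (`α₀ ≥ 0`) ⇒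
there is `θ ∈ I_{α₀}(q₀)` with `Δ_S(h; u; X + θ)` minimal, and `δ_{α₀}(h(X + θ); u; X) ≥ q₀`
again. [cite: CossartPiltant2019, Prop. 2.2–2.3 and §2.3 (arXiv v1 pp. 11–12, 15)] [cite: Hironaka1967, (3.10)] -/
theorem exists_mem_isMinimal_taylor_of_isAdicComplete [IsNoetherianRing S] [IsLocalRing S]
    [IsAdicComplete (maximalIdeal S) S] (u : Fin N → S)
    (H : ∀ (i : Fin N) (T : Finset (Fin N)), i ∉ T →
      ∀ y, u i * y ∈ Ideal.span (u '' ↑T) → y ∈ Ideal.span (u '' ↑T))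
    (hu : ∀ i, u i ∈ maximalIdeal S) {h : S[X]} (hh : h.Monic) {α₀ : Fin N → ℝ}
    (hα₀ : ∀ j, 0 ≤ α₀ j) {q₀ : ℝ} (hΔ : DeltaGE u α₀ h q₀) :
    ∃ θ ∈ monomialIdeal u α₀ q₀, IsMinimal u (taylor θ h) ∧ DeltaGE u α₀ (taylor θ h) q₀ := by
  obtain ⟨θ, hθ, hmin⟩ := exists_mem_isMinimal_taylor u H hu
    (isPrecomplete_of_le_of_isAdicComplete
      (Ideal.span_le.mpr (Set.range_subset_iff.mpr hu)) (maximalIdeal.isMaximal S).ne_top)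
    hh hα₀ hΔ
  exact ⟨θ, hθ, hmin, DeltaGE.taylor hh hθ hΔ⟩

/-- The same with the translate written `h.comp (X + C θ)`.
[cite: CossartPiltant2019, Prop. 2.2–2.3 and §2.3 (arXiv v1 pp. 11–12, 15)] [cite: Hironaka1967, (3.10)] -/
theorem exists_mem_isMinimal_comp_X_add_C [IsNoetherianRing S] [IsLocalRing S]
    [IsAdicComplete (maximalIdeal S) S] (u : Fin N → S)
    (H : ∀ (i : Fin N) (T : Finset (Fin N)), i ∉ T →
      ∀ y, u i * y ∈ Ideal.span (u '' ↑T) → y ∈ Ideal.span (u '' ↑T))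
    (hu : ∀ i, u i ∈ maximalIdeal S) {h : S[X]} (hh : h.Monic) {α₀ : Fin N → ℝ}
    (hα₀ : ∀ j, 0 ≤ α₀ j) {q₀ : ℝ} (hΔ : DeltaGE u α₀ h q₀) :
    ∃ θ ∈ monomialIdeal u α₀ q₀,
      IsMinimal u (h.comp (X + C θ)) ∧ DeltaGE u α₀ (h.comp (X + C θ)) q₀ := by
  obtain ⟨θ, hθ, hmin, hΔ'⟩ := exists_mem_isMinimal_taylor_of_isAdicComplete u H hu hh hα₀ hΔ
  exact ⟨θ, hθ, by rwa [taylor_apply] at hmin, by rwa [taylor_apply] at hΔ'⟩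


/-! ## Dictionary: `I_{𝟙_J}(k) = (u_j : j ∈ J)^k`, and the preparation inside `(u_j : j ∈ J)` -/

/-- The weight for the indicator vector of `J`: `|x|_{𝟙_J} = Σ_{j ∈ J} x_j`. [folklore] -/
private theorem weight_indicator (J : Finset (Fin N)) (x : Fin N → ℕ) :
    weight (fun j => if j ∈ J then (1 : ℝ) else 0) x = ((∑ j ∈ J, x j : ℕ) : ℝ) := by
  classical
  unfold weight
  push_cast
  have : ∀ j, (if j ∈ J then (1 : ℝ) else 0) * (x j : ℝ) = if j ∈ J then (x j : ℝ) else 0 := by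
    intro j; split_ifs <;> simp
  simp_rw [this]
  rw [Finset.sum_ite_mem, Finset.univ_inter]

/-- **`I_{𝟙_J}(k) = (u_j : j ∈ J)^k`**: for the weight vector `𝟙_J` (one on `J`, zero off `J`)
the monomial ideal of weight `≥ k` is the `k`-th power of the ideal of the parameters indexed by
`J` (Cossart–Piltant 2019, v1 p. 9: `I_α(a) := ({u^x : |x|_α ≥ a})`; for `J` = all indices this is
`monomialIdeal_one_natCast`, `I_𝟙(k) = m_S^k`). [cite: CossartPiltant2019, Ch. 2 (arXiv v1 p. 9)] -/
theorem monomialIdeal_indicator_eq_span_pow (u : Fin N → S) (J : Finset (Fin N)) (k : ℕ) :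
    monomialIdeal u (fun j => if j ∈ J then (1 : ℝ) else 0) k = Ideal.span (u '' ↑J) ^ k := by
  classical
  apply le_antisymm
  · unfold monomialIdeal
    apply Ideal.span_le.mpr
    rintro m ⟨x, hx, rfl⟩
    rw [weight_indicator] at hx
    have hk : k ≤ ∑ j ∈ J, x j := by exact_mod_cast hx
    have hsplit : uPow u x = (∏ j ∈ J, u j ^ x j) * ∏ j ∈ Jᶜ, u j ^ x j := by
      rw [uPow, Finset.prod_mul_prod_compl]
    rw [SetLike.mem_coe, hsplit]
    refine Ideal.mul_mem_right _ _ ?_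
    have hmem : (∏ j ∈ J, u j ^ x j) ∈ Ideal.span (u '' ↑J) ^ (∑ j ∈ J, x j) := by
      rw [← Finset.prod_pow_eq_pow_sum]
      refine Ideal.prod_mem_prod fun j hj => Ideal.pow_mem_pow ?_ _
      exact Ideal.subset_span (Set.mem_image_of_mem u (Finset.mem_coe.mpr hj))
    exact Ideal.pow_le_pow_right hk hmem
  · induction k with
    | zero =>
      rw [pow_zero, Ideal.one_eq_top, Nat.cast_zero, monomialIdeal_of_nonpos u _ le_rfl]
    | succ k ih =>
      rw [pow_succ, Nat.cast_succ]
      refine (Ideal.mul_mono ih ?_).trans (monomialIdeal_mul_le u _ _ _)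
      apply Ideal.span_le.mpr
      rintro m ⟨j, hj, rfl⟩
      rw [SetLike.mem_coe, ← uPow_single u j]
      apply uPow_mem_monomialIdeal
      rw [weight_indicator]
      have : ∑ i ∈ J, (Pi.single j 1 : Fin N → ℕ) i = 1 := by
        rw [Finset.sum_eq_single j]
        · simp
        · intro i _ hij; simp [hij]
        · intro hj'; exact absurd (Finset.mem_coe.mp hj) hj'
      rw [this]
      norm_num

/-- **Vertex preparation inside `(u_j : j ∈ J)`** (the form used when the centre of the next
blowing up is `V(Z, u_j : j ∈ J)`): in a complete Noetherian local ring, if the monic `h` has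
`f_{i,X} ∈ (u_j : j ∈ J)^i` for `1 ≤ i ≤ m` — i.e. `Δ_S(h; u; X) ⊆ {Σ_{j ∈ J} x_j ≥ 1}` — then the
preparing translation can be taken with `θ ∈ (u_j : j ∈ J)`, and the prepared polynomial
`h(X + θ)` again has `f_{i,X+θ} ∈ (u_j : j ∈ J)^i`.
[cite: CossartPiltant2019, Prop. 2.2–2.3 and §2.3 (arXiv v1 pp. 11–12, 15)] [cite: Hironaka1967, (3.10)] -/
theorem exists_mem_span_isMinimal_taylor_of_isAdicComplete [IsNoetherianRing S] [IsLocalRing S]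
    [IsAdicComplete (maximalIdeal S) S] (u : Fin N → S)
    (H : ∀ (i : Fin N) (T : Finset (Fin N)), i ∉ T →
      ∀ y, u i * y ∈ Ideal.span (u '' ↑T) → y ∈ Ideal.span (u '' ↑T))
    (hu : ∀ i, u i ∈ maximalIdeal S) {h : S[X]} (hh : h.Monic) (J : Finset (Fin N))
    (hcoef : ∀ i ∈ Finset.Icc 1 h.natDegree,
      h.coeff (h.natDegree - i) ∈ Ideal.span (u '' ↑J) ^ i) :
    ∃ θ ∈ Ideal.span (u '' ↑J), IsMinimal u (taylor θ h) ∧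
      ∀ i ∈ Finset.Icc 1 h.natDegree,
        (taylor θ h).coeff (h.natDegree - i) ∈ Ideal.span (u '' ↑J) ^ i := by
  classical
  have hα₀ : ∀ j, 0 ≤ (fun j => if j ∈ J then (1 : ℝ) else 0) j := by
    intro j
    show 0 ≤ (if j ∈ J then (1 : ℝ) else 0)
    split_ifs <;> norm_num
  have hΔ : DeltaGE u (fun j => if j ∈ J then (1 : ℝ) else 0) h 1 := by
    intro i hi
    rw [mul_one, monomialIdeal_indicator_eq_span_pow]
    exact hcoef i hi
  obtain ⟨θ, hθ, hmin, hΔ'⟩ := exists_mem_isMinimal_taylor_of_isAdicComplete u H hu hh hα₀ hΔ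
  refine ⟨θ, ?_, hmin, fun i hi => ?_⟩
  · have h1 := monomialIdeal_indicator_eq_span_pow u J 1
    rw [pow_one, Nat.cast_one] at h1
    rwa [h1] at hθ
  · have hi' : i ∈ Finset.Icc 1 (taylor θ h).natDegree := by rwa [natDegree_taylor]
    have := hΔ' i hi'
    rwa [natDegree_taylor, mul_one, monomialIdeal_indicator_eq_span_pow] at this

/-- The same with the translate written `h.comp (X + C θ)`.
[cite: CossartPiltant2019, Prop. 2.2–2.3 and §2.3 (arXiv v1 pp. 11–12, 15)] [cite: Hironaka1967, (3.10)] -/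
theorem exists_mem_span_isMinimal_comp_X_add_C [IsNoetherianRing S] [IsLocalRing S]
    [IsAdicComplete (maximalIdeal S) S] (u : Fin N → S)
    (H : ∀ (i : Fin N) (T : Finset (Fin N)), i ∉ T →
      ∀ y, u i * y ∈ Ideal.span (u '' ↑T) → y ∈ Ideal.span (u '' ↑T))
    (hu : ∀ i, u i ∈ maximalIdeal S) {h : S[X]} (hh : h.Monic) (J : Finset (Fin N))
    (hcoef : ∀ i ∈ Finset.Icc 1 h.natDegree,
      h.coeff (h.natDegree - i) ∈ Ideal.span (u '' ↑J) ^ i) :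
    ∃ θ ∈ Ideal.span (u '' ↑J), IsMinimal u (h.comp (X + C θ)) ∧
      ∀ i ∈ Finset.Icc 1 h.natDegree,
        (h.comp (X + C θ)).coeff (h.natDegree - i) ∈ Ideal.span (u '' ↑J) ^ i := by
  obtain ⟨θ, hθ, hmin, hc⟩ := exists_mem_span_isMinimal_taylor_of_isAdicComplete u H hu hh J hcoef
  refine ⟨θ, hθ, by rwa [taylor_apply] at hmin, fun i hi => ?_⟩
  rw [← taylor_apply]
  exact hc i hi

/-! ## Packaging for regular systems of parameters (the consumer binder `hVP`)

[CossartPiltant2019] Prop. 2.2 is stated for `(u₁, …, u_n)` part of a regular system of parameters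
of the regular local ring `S`.  Hypothesis (H) and `uᵢ ∈ 𝔪` then hold by Matsumura Thms. 14.3/17.8
as formalized in `MonomialIdealsRegularParameters.lean` (`IsRsopPart.mem_span_image_of_mul_mem`,
`mem_span_image_of_mul_mem_rsop`) and `RsopMonomialIdeals.lean` (`IsRsopPart.mem_maximalIdeal`),
and a regular local ring is Noetherian, so the theorems above specialise to the printed setting
with no hypothesis left over.  The last statements are in the shape of the binder `hVP` of
`exists_isCPFrame_of_presentation` (Summits, `…Corridor3WLadderCPFrameTranslate`): a family
`u : Fin n → S` generating `𝔪_S` with `n = dim S` (equivalently `n = spanFinrank 𝔪_S`), i.e. a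
regular system of parameters; the bound `2 ≤ deg h` of that binder is not needed. -/

/-- **[CP2019] Prop. 2.2 (1) (Hironaka's vertex preparation) for a part of a regular system of
parameters** `u₁, …, u_N` of a complete regular local ring `S`: every monic `h ∈ S[X]` has a
translate `h(X + θ)` whose characteristic polyhedron `Δ(h; u; X + θ)` has no solvable vertex.
[cite: CossartPiltant2019, Prop. 2.2 (1) and Def. 2.4 (arXiv v1 pp. 11–12)]
[cite: Hironaka1967, Thm. (4.7) via (3.10), (3.13), (3.17)] -/
theorem exists_isMinimal_taylor_of_isRsopPart [IsLocalRing S] [IsAdicComplete (maximalIdeal S) S]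
    {u : Fin N → S} (hz : IsRsopPart u) {h : S[X]} (hh : h.Monic) :
    ∃ θ : S, IsMinimal u (taylor θ h) := by
  haveI := hz.isRegularLocalRing
  exact exists_isMinimal_taylor_of_isAdicComplete u hz.mem_span_image_of_mul_mem
    hz.mem_maximalIdeal hh

/-- The refined form for a part of a regular system of parameters: the preparing translation may
be taken in `(u_j : j ∈ J)` when `h` satisfies the coefficient conditions
`f_i ∈ (u_j : j ∈ J)^i` (`f_i` the coefficient of `X^{m-i}`), and the translate again satisfies
them. [cite: CossartPiltant2019, Prop. 2.2–2.3 and §2.3 (arXiv v1 pp. 11–12, 15)]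
[cite: Hironaka1967, (3.10)] -/
theorem exists_mem_span_isMinimal_taylor_of_isRsopPart [IsLocalRing S]
    [IsAdicComplete (maximalIdeal S) S] {u : Fin N → S} (hz : IsRsopPart u) {h : S[X]}
    (hh : h.Monic) (J : Finset (Fin N))
    (hcoef : ∀ i ∈ Finset.Icc 1 h.natDegree,
      h.coeff (h.natDegree - i) ∈ Ideal.span (u '' ↑J) ^ i) :
    ∃ θ ∈ Ideal.span (u '' ↑J), IsMinimal u (taylor θ h) ∧
      ∀ i ∈ Finset.Icc 1 h.natDegree,
        (taylor θ h).coeff (h.natDegree - i) ∈ Ideal.span (u '' ↑J) ^ i := by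
  haveI := hz.isRegularLocalRing
  exact exists_mem_span_isMinimal_taylor_of_isAdicComplete u hz.mem_span_image_of_mul_mem
    hz.mem_maximalIdeal hh J hcoef

/-- **[CP2019] Prop. 2.2 (1) for a regular system of parameters in the `(hd, u, hu)` format** of
`RegularSystemOfParameters.lean`: `S` complete regular local, `u₁, …, u_d` a minimal basis of
`𝔪_S` (`d = spanFinrank 𝔪_S`), `h` monic ⇒ some translate `h(X + θ)` has no solvable vertex.
[cite: CossartPiltant2019, Prop. 2.2 (1) and Def. 2.4 (arXiv v1 pp. 11–12)]
[cite: Hironaka1967, Thm. (4.7) via (3.10)] -/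
theorem exists_isMinimal_taylor_of_rsop [IsRegularLocalRing S] [IsAdicComplete (maximalIdeal S) S]
    {d : ℕ} (hd : (maximalIdeal S).spanFinrank = d) (u : Fin d → S)
    (hu : Ideal.span (Set.range u) = maximalIdeal S) {h : S[X]} (hh : h.Monic) :
    ∃ θ : S, IsMinimal u (taylor θ h) :=
  exists_isMinimal_taylor_of_isAdicComplete u (mem_span_image_of_mul_mem_rsop hd u hu)
    (fun i => hu ▸ Ideal.subset_span ⟨i, rfl⟩) hh

/-- In a regular local ring of dimension `n`, the maximal ideal has `spanFinrank = n`.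
[cite: Matsumura1987, §14 (definition of a regular local ring)] -/
theorem spanFinrank_maximalIdeal_eq_of_ringKrullDim_eq [IsRegularLocalRing S] {n : ℕ}
    (hn : ringKrullDim S = n) : (maximalIdeal S).spanFinrank = n := by
  have h := IsRegularLocalRing.spanFinrank_maximalIdeal (R := S)
  rw [hn] at h
  exact_mod_cast h

/-- **The binder `hVP` discharged** (shape of `exists_isCPFrame_of_presentation`, with the
dimension count that makes `u` a regular system of parameters): `S` complete regular local of
dimension `n`, `u : Fin n → S` generating `𝔪_S`, `h` monic ⇒ `∃ θ, Δ(h; u; X + θ)` has no solvable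
vertex, the translate written `h.comp (X + C θ)`.
[cite: CossartPiltant2019, Prop. 2.2 (1) and Def. 2.4 (arXiv v1 pp. 11–12)]
[cite: Hironaka1967, Thm. (4.7) via (3.10)] -/
theorem exists_isMinimal_comp_X_add_C_of_span_eq_maximalIdeal [IsRegularLocalRing S]
    [IsAdicComplete (maximalIdeal S) S] {n : ℕ} (u : Fin n → S)
    (hu : Ideal.span (Set.range u) = maximalIdeal S) (hn : ringKrullDim S = n) {h : S[X]}
    (hh : h.Monic) : ∃ θ : S, IsMinimal u (h.comp (X + C θ)) := by
  obtain ⟨θ, hθ⟩ :=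
    exists_isMinimal_taylor_of_rsop (spanFinrank_maximalIdeal_eq_of_ringKrullDim_eq hn) u hu hh
  exact ⟨θ, by rwa [taylor_apply] at hθ⟩

/-- The refined form in the same format: with the coefficient conditions
`f_i ∈ (u_j : j ∈ J)^i`, the preparing `θ` may be taken in `(u_j : j ∈ J)` and the translate
keeps the conditions. [cite: CossartPiltant2019, Prop. 2.2–2.3 and §2.3 (arXiv v1 pp. 11–12, 15)]
[cite: Hironaka1967, (3.10)] -/
theorem exists_mem_span_isMinimal_comp_X_add_C_of_span_eq_maximalIdeal [IsRegularLocalRing S]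
    [IsAdicComplete (maximalIdeal S) S] {n : ℕ} (u : Fin n → S)
    (hu : Ideal.span (Set.range u) = maximalIdeal S) (hn : ringKrullDim S = n) {h : S[X]}
    (hh : h.Monic) (J : Finset (Fin n))
    (hcoef : ∀ i ∈ Finset.Icc 1 h.natDegree,
      h.coeff (h.natDegree - i) ∈ Ideal.span (u '' ↑J) ^ i) :
    ∃ θ ∈ Ideal.span (u '' ↑J), IsMinimal u (h.comp (X + C θ)) ∧
      ∀ i ∈ Finset.Icc 1 h.natDegree,
        (h.comp (X + C θ)).coeff (h.natDegree - i) ∈ Ideal.span (u '' ↑J) ^ i :=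
  exists_mem_span_isMinimal_comp_X_add_C u
    (mem_span_image_of_mul_mem_rsop (spanFinrank_maximalIdeal_eq_of_ringKrullDim_eq hn) u hu)
    (fun i => hu ▸ Ideal.subset_span ⟨i, rfl⟩) hh J hcoef

end Literature.AlgebraicGeometry.Resolution.CossartPiltant

end
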